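import Literature.MathematicalPhysics.QuantumFieldTheory.Balaban1983to89.B9LettersZCFieldsAtPinsB
import Literature.MathematicalPhysics.QuantumFieldTheory.Balaban1983to89.B9Thm313WholeQstarFromG0
import Literature.MathematicalPhysics.QuantumFieldTheory.Balaban1983to89.B9BackgroundsKLevelV1R
import Literature.MathematicalPhysics.QuantumFieldTheory.Balaban1983to89.Node00.OpsYOps312OfRecordPar
import Literature.MathematicalPhysics.QuantumFieldTheory.Balaban1983to89.B9LettersZSchemasMono
import Literature.MathematicalPhysics.QuantumFieldTheory.Balaban1983to89.B9Thm312WholeHZ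
import Literature.MathematicalPhysics.QuantumFieldTheory.Balaban1983to89.B9LettersHZAtOne

/-!
# BalabanUVNodes ∕ N06 ([B9], `Dag.B9_main`) — CASCADE-K PIECE K2 (director-ym №383): THE DERIVED Z-LETTERS LEG `…N06ZLettersLegAtPinsPU.zletters_of_pins`
# RE-PRESSED GENERIC IN THE AVERAGING PAIR `(𝔮, 𝔮⋆)`, THE SITE TRANSPORTER `parS` AND THE RESIDUAL LETTER `Δ⁽²⁾` — the straight-pair pins of `Q ∕ Q⋆`
# (`hQco12 hQsco12 : … = QcoKH ∕ QscoKH … parBY …`) REPLACED by two displayed LAWS, the pins of `C ∕ C₁` read through node00-def-Y's `𝔮`-generic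
# coordinate models `CcoKq ∕ C1coKq` (`Node00.OpsYOps312OfRecordPar` §0), ROW 26 read through the `𝔮`-generic (3.132) letters `QGQinvQY ∕ QG1QinvQY`

Track A of `YM-PLAN.md` (cell `pub-ymgap`, HUMAN RULING D-0062), node **N06** = [Balaban1985BackgroundPropagators] Thms 3.1–3.15; bundle F7 rows 20–21, seat
`pub-ymgap-dag-n06-l` (g37).  A HELPER for the knit certificate «K» of CASCADE-K (director-ym №383 «the knit instance enters the N06 certificate only via a
parametric re-press over the site transporter»; dag-n06-d g25's K3 skeleton `…N06AtOpsYSectEStKnitPairKA` displays `t312K t313K`, whose supplier — the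
companion «K3-D» — calls the rows-20∕21 assembler `…N06Thm312313AtPinsStateSUCLEPar.t312_t313_of_pins_stateSUCLE_par`, which `obtain`s from THIS leg).
WHY.  `…N06ZLettersLegAtPinsPU.zletters_of_pins` (g30) derives the seven Z-letters of rows 20–21 (`q2 q1` of `Q`, `gQs2 dgQs` of `G₀Q⋆ ∕ ∇_UG₀Q⋆`, `c2 c12 c1_1`
of `C = (QG̃Q⋆)⁻¹ ∕ C₁ = (QG₁Q⋆)⁻¹`) at the pins of TODAY's record: `Q = QcoKH … parBY` and `Q⋆ = QscoKH … parBY` (the straight-contour pair `(QY parBY, QsY parBY)`,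
read by dag-n06-w5's `hasMaj_Q_of_pins` ∕ `gQs2_pinsB ∕ dgQs_pinsB`), `C ∕ C₁ = CcoK ∕ C1coK … parSymY parBY (GpPhysY parSymY) …` and row 26 over
`QGQinvY ∕ QG1QinvY … parSymY …`.  At the KNIT letters of record (`Node00.OpsYRecordV11.lettersYOfRecordV11K`: averaging pair `(qKnitOfRecord, qsKnitOfRecord)` =
print's (3.115) knit letter, site transporter `parKnitY` of [Balaban1985Averaging] Prop. 2) those pins are FALSE; def-Y's `Node00.OpsYOps312OfRecordPar` makes the
Sect.-D operator record parametric ONCE in `(𝔏, 𝔮, 𝔮⋆, parS)` with the twenty-two pins `pins312Par_of_eq`.  THIS FILE is the leg in those shapes: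
★★★ `zletters_of_laws` — `zletters_of_pins` with (i) the letters of `Q` DISPLAYED as a law `hqK` (`Q : 𝔠⁽ᵖ⁾ → 𝔠_Z⁽ᵖ⁾`, `p ≤ 2`, majorant `BQp·e^{−δ12₃ d}`; today =
w5's `hasMaj_Q_of_pins` + the (2.60) numerics, knit = dag-n06-c's (L7) sizes of the knit letter), (ii) the `Q⋆`-majorant DISPLAYED as the law `hqsK` of
`…N06G0QstarLettersLegAtPinsPUPar` (✓, same binder shape: `Q⋆ : 𝔠⁽⁰⁾ → Z_{n⁻¹}`, majorant `BQ·e^{−δQ d}`, `δQ ≥ δ12₃ + σ12`; engines `B9Thm313WholeQstarFromG0.gQs2_of_e0 ∕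
dgQs_of_e1`), (iii) the pins `hCco12 ∕ hC1co12` over `CcoKq ∕ C1coKq … (𝔮 x.toKIdx) (𝔮s x.toKIdx) (parS x.toKIdx) (GpPhysY x.toKIdx (parS x.toKIdx)) [Δ2 x]` and
`h26` over the `ν`-readings of `QGQinvQY ∕ QG1QinvQY` at the same data — dag-n06-i's operator-generic engine `hasMaj_cNorm_weightNorm_coordOpK_geo9Y_of_ineq3132Nu`
and w5's threshold transfer `c1_1_of_c1_2_transfer`, packaged operator-generically in §1 (`c_letters_of_row26K`, the twin of `B9LettersZCFieldsAtPinsB.c_letters_of_row26B`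
for ANY pair of coarse-site letter families `T ∕ T₁`).  Conclusion: `zletters_of_pins`'s seven letters + the packaged `LettersHZ … Bz (min δ12₃ δC)`, VERBATIM.
At today's record (`𝔮 := fun i => QY i (parBY i)`, `𝔮s := fun i => QsY i (parBY i)`, `parS := parSymY`) the pins are `zletters_of_pins`'s by `CcoKq_QY ∕ C1coKq_QY`
(`rfl`); the master-rate bookkeeping `scaled_rates` is `…N06ZLettersLegAtPinsPU`'s (unchanged, not restated).
HONEST FRAMING.  By-name composition of kernel-checked helper files; the G₀-layer letters, the two laws and row 26's statement are HYPOTHESES (the node's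
content); COUNT-NEUTRAL; nothing of [B9]'s propagator estimates asserted; N06 NOT discharged; K1 NOT closed; one finite 𝕋⁴ programme at fixed `ε` — NOT
continuum, NOT OS, NOT the mass gap ∕ Clay.  0 `def`, 0 `sorry`.
-/

noncomputable section

namespace Summit.QuantumFields.YangMills.BalabanUVNodes.N06ZLettersLegAtPinsPUPar

open scoped Matrix.Norms.L2Operator
open Literature.MathematicalPhysics.QuantumFieldTheory.Balaban1983to89
open Literature.MathematicalPhysics.QuantumFieldTheory.Balaban1983to89.Node00
open Literature.MathematicalPhysics.QuantumFieldTheory.Balaban1983to89.B6KLevelCensusIndexV1 (KIdx)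
open Literature.MathematicalPhysics.QuantumFieldTheory.Balaban1983to89.B9PinMembersKLevelV1 (MemberY geo9Y bg9Y)
open Literature.MathematicalPhysics.QuantumFieldTheory.Balaban1983to89.B9BackgroundsKLevelV1R (RegFamY bg9YR MemOfFam mem_of_reg335R)
open Literature.MathematicalPhysics.QuantumFieldTheory.Balaban1983to89.B7Prop2SpecialUnitary (specialUnitaryUnits)
open Literature.MathematicalPhysics.QuantumFieldTheory.Balaban1983to89.B6Ineq2142KLevelV1 (β lvl)
open Literature.MathematicalPhysics.QuantumFieldTheory.Balaban1983to89.B6RandomWalkHom (HasMajorantHom)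
open Literature.MathematicalPhysics.QuantumFieldTheory.Balaban1983to89.B9CoReadingCoordsTranspose (TrIdx trBasis)
open Literature.MathematicalPhysics.QuantumFieldTheory.Balaban1983to89.B9CoReadingCoords (XBK coordOpK)
open Literature.MathematicalPhysics.QuantumFieldTheory.Balaban1983to89.B9CoReadingCoordsH (XHK blkHK)
open Literature.MathematicalPhysics.QuantumFieldTheory.Balaban1983to89.B9GeoNormsKLevelV1 (geo9K geo9K_dist_nonneg)
open Literature.MathematicalPhysics.QuantumFieldTheory.Balaban1983to89.B9GeoLemma21KLevelV1 (geo9Y_dist_triangle geo9Y_dist_comm geo9Y_len_pos rowSum261_geo9Y)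
open Literature.MathematicalPhysics.QuantumFieldTheory.Balaban1983to89.B9Thm34Ext (toB6)
open Literature.MathematicalPhysics.QuantumFieldTheory.Balaban1983to89.B9SectDSup (weightNorm)
open Literature.MathematicalPhysics.QuantumFieldTheory.Balaban1983to89.B11SectG (HasMaj BlockNorm RowSum)
open Literature.MathematicalPhysics.QuantumFieldTheory.Balaban1983to89.B9Thm312Whole (Ops GeoOK cNorm Thm33G0)
open Literature.MathematicalPhysics.QuantumFieldTheory.Balaban1983to89.B9Thm312WholeHZ (LettersHZ)
open Literature.MathematicalPhysics.QuantumFieldTheory.Balaban1983to89.B9LettersHZAtOne (plateau_pos)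
open Literature.MathematicalPhysics.QuantumFieldTheory.Balaban1983to89.B9PerturbationMajorantAlgebra (hasMaj_weaken)
open Literature.MathematicalPhysics.QuantumFieldTheory.Balaban1983to89.Node00.OpsYOps312OfRecordPar (CcoKq C1coKq)
open Literature.MathematicalPhysics.QuantumFieldTheory.Balaban1983to89.Node00.OpsYQLetter (QFamY QsFamY)
open Literature.MathematicalPhysics.QuantumFieldTheory.Balaban1983to89.B9Eq3132NuReading (siteKernelOfOpNu nuY)
open Literature.MathematicalPhysics.QuantumFieldTheory.Balaban1983to89.B9Eq3132ClassLetterFromNu (hasMaj_cNorm_weightNorm_coordOpK_geo9Y_of_ineq3132Nu)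
open Literature.MathematicalPhysics.QuantumFieldTheory.Balaban1983to89.B9Thm39ReadingCoords (cR39 cR39_nonneg coordBound39 basisBound39 abs_repr_le)
open Literature.MathematicalPhysics.QuantumFieldTheory.Balaban1983to89.B9LettersZCFieldsAtPins (const3132_le)
open Literature.MathematicalPhysics.QuantumFieldTheory.Balaban1983to89.B9LettersZCFieldsAtPinsB (c1_1_of_c1_2_transfer)
open Literature.MathematicalPhysics.QuantumFieldTheory.Balaban1983to89.B9LettersZSchemasMono (kernel_mono)
open Literature.MathematicalPhysics.QuantumFieldTheory.Balaban1983to89.B9Thm313WholeQstarFromG0 (gQs2_of_e0 dgQs_of_e1)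

variable {N : ℕ}

/-! ## §1 ROW 26 ⟹ the three (3.132) class letters, member-uniformly, for ANY pair of coarse-site letter families read in coordinates -/

/-- ★★ **`B9LettersZCFieldsAtPinsB.c_letters_of_row26B` OPERATOR-GENERIC**: for any background family `bg` with configuration maps `cfg`, any two
coarse-site letter families `T ∕ T₁` (today `QGQinvY ∕ QG1QinvY … parSymY …`; at the knit `QGQinvQY ∕ QG1QinvQY` over the knit pair and `parKnitY`), an `Ops`
record whose `C ∕ C₁` fields are PINNED to the coordinate models `cR39·coordOpK (T(U)) ∕ cR39·coordOpK (T₁(U))` (`hC ∕ hC1`) and `blkZ = blkHK` (`hblkZ`), ROW 26's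
printed statement for the `ν`-readings of `T ∕ T₁` (`h26`, HYPOTHESIS) gives `M₄, δC, a₀, BC > 0` and, above them, the class letters `LettersHZ.c2` (`C : 𝔠_Z⁽²⁾ →
Z_{n⁻¹}`), `c12` (`C₁ : 𝔠_Z⁽²⁾ → Z_{n⁻¹}`) and `c1_1` (`C₁ : 𝔠_Z⁽¹⁾ → Z_{len·n⁻¹}`) with the common majorant `BC·e^{−δC d}` (`δC = δ₁∕4` for row 26's produced `δ₁`)
— `c_letters_of_row26B`'s proof with dag-n06-i's operator-generic engine `hasMaj_cNorm_weightNorm_coordOpK_geo9Y_of_ineq3132Nu` called directly.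
[cite: Balaban1985BackgroundPropagators, (3.132) p.422 (statement before Thm 3.12) + (3.123) p.420 + (3.129) p.421 + Thm 3.13 p.426 + p.398 (remark after (3.47)); Balaban1984PropagatorsII, (2.51) p.232 + Lemma 2.1 (2.60) p.234] -/
theorem c_letters_of_row26K {d ℓ : ℕ} {hd : 1 ≤ d + 1} {hL : Odd (ℓ + 1) ∧ 1 < ℓ + 1} {b₀ b₁ : ℝ} {Mstar : ℕ}
    [∀ x : MemberY d ℓ hd hL b₀ b₁ Mstar, Fintype (geo9Y x).Site]
    (bg : MemberY d ℓ hd hL b₀ b₁ Mstar → B9.Backgrounds)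
    (cfg : ∀ x : MemberY d ℓ hd hL b₀ b₁ Mstar, (bg x).Cfg → CfgY (Matrix (Fin N) (Fin N) ℂ) x.toKIdx)
    (T T₁ : ∀ x : MemberY d ℓ hd hL b₀ b₁ Mstar, CfgY (Matrix (Fin N) (Fin N) ℂ) x.toKIdx → (IBondY x.toKIdx → Matrix (Fin N) (Fin N) ℂ) →ₗ[ℂ] (IBondY x.toKIdx → Matrix (Fin N) (Fin N) ℂ))
    {X Y W : MemberY d ℓ hd hL b₀ b₁ Mstar → Type} [∀ x, Fintype (X x)] [∀ x, Fintype (Y x)] [∀ x, Fintype (W x)]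
    (𝔬 : ∀ x : MemberY d ℓ hd hL b₀ b₁ Mstar, Ops (geo9Y x) (bg x) (X x) (Y x) (XHK (TrIdx N) x.toKIdx) (W x))
    (H : MemberY d ℓ hd hL b₀ b₁ Mstar → Prop) {c35 : ℝ}
    (hblkZ : ∀ x, (𝔬 x).blkZ = blkHK x.toKIdx)
    (hC : ∀ x U, (𝔬 x).C U = cR39 (trBasis N) • coordOpK (trBasis N) (fun _ : Fin (d + 1) => (T x (cfg x U)).restrictScalars ℝ))
    (hC1 : ∀ x U, (𝔬 x).C1 U = cR39 (trBasis N) • coordOpK (trBasis N) (fun _ : Fin (d + 1) => (T₁ x (cfg x U)).restrictScalars ℝ))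
    (hpl : ∀ (x : MemberY d ℓ hd hL b₀ b₁ Mstar) (y : (geo9Y x).Site), 0 ≤ ((((ℓ + 1 : ℕ) : ℝ) ^ (d + 1)) ^ lvl x.hN x.D x.hk y)⁻¹)
    (hpl' : ∀ (x : MemberY d ℓ hd hL b₀ b₁ Mstar) (y : (geo9Y x).Site), 0 ≤ (geo9Y x).len y * ((((ℓ + 1 : ℕ) : ℝ) ^ (d + 1)) ^ lvl x.hN x.D x.hk y)⁻¹)
    (h26 : B9.Stmt3132Printed (d + 1) c35 (geo9Y (d := d) (ℓ := ℓ) (hd := hd) (hL := hL) (b₀ := b₀) (b₁ := b₁) (Mstar := Mstar)) bg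
      (fun x => siteKernelOfOpNu x.toKIdx (bg x) (cfg x) (nuY (d + 1) x.toKIdx) (T x))
      (fun x => siteKernelOfOpNu x.toKIdx (bg x) (cfg x) (nuY (d + 1) x.toKIdx) (T₁ x))) :
    ∃ M₄ δC a₀ BC : ℝ, 0 < M₄ ∧ 0 < δC ∧ 0 < a₀ ∧ 0 < BC ∧
      ∀ x : MemberY d ℓ hd hL b₀ b₁ Mstar, M₄ ≤ (geo9Y x).M → ∀ α₀ : ℝ, 0 < α₀ → (geo9Y x).M * α₀ ≤ a₀ →
        ∀ U : (bg x).Cfg, (bg x).Reg335 c35 α₀ U → (bg x).Reg336 c35 α₀ U →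
          HasMaj (cNorm 1 (H x) (𝔬 x).blkZ (fun y => (geo9Y_len_pos x y).le) 2)
              (weightNorm (BlockNorm.ofBlocks (toB6 (geo9Y x) 1 (H x)) (𝔬 x).blkZ)
                (fun y => ((((ℓ + 1 : ℕ) : ℝ) ^ (d + 1)) ^ lvl x.hN x.D x.hk y)⁻¹) (hpl x))
              ((𝔬 x).C U) (fun a b => BC * Real.exp (-(δC * (geo9Y x).dist a b))) ∧
            HasMaj (cNorm 1 (H x) (𝔬 x).blkZ (fun y => (geo9Y_len_pos x y).le) 2)
              (weightNorm (BlockNorm.ofBlocks (toB6 (geo9Y x) 1 (H x)) (𝔬 x).blkZ)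
                (fun y => ((((ℓ + 1 : ℕ) : ℝ) ^ (d + 1)) ^ lvl x.hN x.D x.hk y)⁻¹) (hpl x))
              ((𝔬 x).C1 U) (fun a b => BC * Real.exp (-(δC * (geo9Y x).dist a b))) ∧
            HasMaj (cNorm 1 (H x) (𝔬 x).blkZ (fun y => (geo9Y_len_pos x y).le) 1)
              (weightNorm (BlockNorm.ofBlocks (toB6 (geo9Y x) 1 (H x)) (𝔬 x).blkZ)
                (fun y => (geo9Y x).len y * ((((ℓ + 1 : ℕ) : ℝ) ^ (d + 1)) ^ lvl x.hN x.D x.hk y)⁻¹) (hpl' x))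
              ((𝔬 x).C1 U) (fun a b => BC * Real.exp (-(δC * (geo9Y x).dist a b))) := by
  obtain ⟨M₄, δ₁, a₀, C, hM₄, hδ₁, ha₀, hC0, hall⟩ := h26
  have hK1 : (1 : ℝ) ≤ 2 * ((ℓ : ℝ) + 1) ^ 2 - 1 := by nlinarith [(Nat.cast_nonneg ℓ : (0 : ℝ) ≤ ℓ)]
  -- the class-reading threshold (gap δ₁/2) and the transfer threshold (ε = δ₁/4)
  set Kg : ℝ := (δ₁ - δ₁ / 2) * (2 * ((ℓ : ℝ) + 1) ^ 2 - 1) with hKg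
  have hKg0 : 0 < Kg := mul_pos (by linarith) (by linarith)
  set Kt : ℝ := δ₁ / 4 * (2 * ((ℓ : ℝ) + 1) ^ 2 - 1) with hKt
  have hKt0 : 0 < Kt := mul_pos (by linarith) (by linarith)
  set M₀ : ℝ := 2 * Real.log (((ℓ + 1 : ℕ) : ℝ)) / Kg with hM₀
  set M₀' : ℝ := 1 * Real.log (((ℓ + 1 : ℕ) : ℝ)) / Kt with hM₀'
  set A : ℝ := cR39 (trBasis N) * (coordBound39 (trBasis N) * basisBound39 (trBasis N)) * C * (((ℓ + 1 : ℕ) : ℝ)) ^ 2 with hA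
  have hA0 : 0 ≤ A := by
    have h1 : 0 ≤ coordBound39 (trBasis N) := norm_nonneg _
    have h2 : 0 ≤ basisBound39 (trBasis N) := Finset.sum_nonneg fun _ _ => norm_nonneg _
    have h3 := cR39_nonneg (trBasis N)
    positivity
  set BC : ℝ := A * (((ℓ + 1 : ℕ) : ℝ)) + 1 with hBC
  have hL1 : (1 : ℝ) ≤ ((ℓ + 1 : ℕ) : ℝ) := by exact_mod_cast Nat.succ_le_succ (Nat.zero_le ℓ)
  have hABC : A ≤ BC := by
    have h1 : A ≤ A * (((ℓ + 1 : ℕ) : ℝ)) := le_mul_of_one_le_right hA0 hL1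
    linarith
  have hBC0 : 0 < BC := by positivity
  refine ⟨max M₄ (max M₀ M₀'), δ₁ / 4, a₀, BC, lt_max_of_lt_left hM₄, by positivity, ha₀, hBC0, fun x hM α₀ hα ha U hU hU' => ?_⟩
  letI : Fintype (geo9K x.toKIdx).Site := (inferInstance : Fintype (geo9Y x).Site)
  have hgeo : GeoOK (geo9Y x) := ⟨geo9Y_dist_triangle x, geo9Y_dist_comm x, geo9K_dist_nonneg x.toKIdx, geo9Y_len_pos x⟩
  have hM4 : M₄ ≤ (geo9Y x).M := (le_max_left _ _).trans hM
  have hgap : 2 * Real.log (((ℓ + 1 : ℕ) : ℝ)) ≤ (δ₁ - δ₁ / 2) * (2 * ((ℓ : ℝ) + 1) ^ 2 - 1) * (geo9Y x).M := by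
    have h0 : M₀ ≤ (geo9Y x).M := ((le_max_left _ _).trans (le_max_right _ _)).trans hM
    rw [hM₀, div_le_iff₀ hKg0] at h0
    simpa [hKg, mul_comm, mul_left_comm, mul_assoc] using h0
  have hthr : (1 : ℝ) * Real.log (geo9K x.toKIdx).L ≤ δ₁ / 4 * (2 * ((ℓ : ℝ) + 1) ^ 2 - 1) * (geo9K x.toKIdx).M := by
    have h0 : M₀' ≤ (geo9Y x).M := ((le_max_right _ _).trans (le_max_right _ _)).trans hM
    rw [hM₀', div_le_iff₀ hKt0] at h0
    calc (1 : ℝ) * Real.log (geo9K x.toKIdx).L = 1 * Real.log (((ℓ + 1 : ℕ) : ℝ)) := rfl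
      _ ≤ (geo9Y x).M * Kt := h0
      _ = δ₁ / 4 * (2 * ((ℓ : ℝ) + 1) ^ 2 - 1) * (geo9K x.toKIdx).M := by rw [hKt]; show _ = _ * (geo9Y x).M; ring
  have hboth := hall x hM4 α₀ hα ha U hU hU'
  -- dag-n06-i's engine for the two letter families, read through the pins (`B9LettersZCFieldsAtPinsB.c2_pinsB ∕ c12_pinsB` verbatim, operator-generic)
  have hc2 : HasMaj (cNorm 1 (H x) (𝔬 x).blkZ (fun y => (geo9Y_len_pos x y).le) 2)
      (weightNorm (BlockNorm.ofBlocks (toB6 (geo9Y x) 1 (H x)) (𝔬 x).blkZ) (fun y => ((((ℓ + 1 : ℕ) : ℝ) ^ (d + 1)) ^ lvl x.hN x.D x.hk y)⁻¹) (hpl x))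
      ((𝔬 x).C U) (fun a b => A * Real.exp (-(δ₁ / 2 * (geo9Y x).dist a b))) := by
    have h := hasMaj_cNorm_weightNorm_coordOpK_geo9Y_of_ineq3132Nu (trBasis N) x (bg x) (cfg x) (T x)
      (norm_nonneg _) (abs_repr_le (trBasis N)) 1 (H x) (cR39 (trBasis N)) U (fun y => (geo9Y_len_pos x y).le) (hpl x) hC0.le (half_lt_self hδ₁) hgap hboth.1
    rw [hblkZ x, hC x U]
    exact h.mono fun a b' => mul_le_mul_of_nonneg_right (const3132_le le_rfl) (Real.exp_nonneg _)
  have hc12 : HasMaj (cNorm 1 (H x) (𝔬 x).blkZ (fun y => (geo9Y_len_pos x y).le) 2)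
      (weightNorm (BlockNorm.ofBlocks (toB6 (geo9Y x) 1 (H x)) (𝔬 x).blkZ) (fun y => ((((ℓ + 1 : ℕ) : ℝ) ^ (d + 1)) ^ lvl x.hN x.D x.hk y)⁻¹) (hpl x))
      ((𝔬 x).C1 U) (fun a b => A * Real.exp (-(δ₁ / 2 * (geo9Y x).dist a b))) := by
    have h := hasMaj_cNorm_weightNorm_coordOpK_geo9Y_of_ineq3132Nu (trBasis N) x (bg x) (cfg x) (T₁ x)
      (norm_nonneg _) (abs_repr_le (trBasis N)) 1 (H x) (cR39 (trBasis N)) U (fun y => (geo9Y_len_pos x y).le) (hpl x) hC0.le (half_lt_self hδ₁) hgap hboth.2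
    rw [hblkZ x, hC1 x U]
    exact h.mono fun a b' => mul_le_mul_of_nonneg_right (const3132_le le_rfl) (Real.exp_nonneg _)
  have hδ' : δ₁ / 4 ≤ δ₁ / 2 - δ₁ / 4 := by linarith
  have hB' : A * (geo9K x.toKIdx).L ≤ BC := by show A * (((ℓ + 1 : ℕ) : ℝ)) ≤ BC; linarith
  have hc12' : HasMaj (cNorm 1 (H x) (blkHK x.toKIdx) (fun y => (geo9Y_len_pos x y).le) 2)
      (weightNorm (BlockNorm.ofBlocks (toB6 (geo9Y x) 1 (H x)) (blkHK x.toKIdx)) (fun y => ((((ℓ + 1 : ℕ) : ℝ) ^ (d + 1)) ^ lvl x.hN x.D x.hk y)⁻¹) (hpl x))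
      ((𝔬 x).C1 U) (fun a b => A * Real.exp (-(δ₁ / 2 * (geo9Y x).dist a b))) := by rw [← hblkZ x]; exact hc12
  have hc11 := c1_1_of_c1_2_transfer x.toKIdx hgeo (by positivity : (0 : ℝ) < δ₁ / 4) hthr
    (fun y => by positivity) (hpl' x) hA0 hB' hδ' hc12'
  refine ⟨hasMaj_weaken hgeo hA0 hABC (by linarith : δ₁ / 4 ≤ δ₁ / 2) hc2, hasMaj_weaken hgeo hA0 hABC (by linarith : δ₁ / 4 ≤ δ₁ / 2) hc12, ?_⟩
  rw [hblkZ x]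
  exact hc11

/-! ## §2 The derived Z-letters of rows 20–21, member-uniformly, generic in `(𝔮, 𝔮⋆, parS, Δ⁽²⁾)` with the `Q ∕ Q⋆` letters displayed as laws -/

/-- ★★★ **THE DERIVED Z-LETTERS OF ROWS 20–21, MEMBER-UNIFORMLY, GENERIC IN THE AVERAGING PAIR AND THE SITE TRANSPORTER** (module docstring): from the
displayed laws `hqK` (`Q : 𝔠⁽ᵖ⁾ → 𝔠_Z⁽ᵖ⁾`, `p ≤ 2`, `BQp·e^{−δ12₃d}`) and `hqsK` (`Q⋆ : 𝔠⁽⁰⁾ → Z_{n⁻¹}`, `BQ·e^{−δQ d}`, `δQ ≥ δ12₃ + σ12`), the pins of `C ∕ C₁` over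
node00-def-Y's `𝔮`-generic models `CcoKq ∕ C1coKq` at `(𝔮, 𝔮⋆, parS, GpPhysY parS, Δ2)` and `blkZ = blkHK`, the G₀ layer's sup letter (`hG0e`) and (3.42)₁
homogeneous majorant (`he1`), ROW 26 as the certificate holds it over the `ν`-readings of `QGQinvQY ∕ QG1QinvQY` at the same data (`h26`), and a rate `0 < σ12`,
ONE `obtain` gives `Mz ≥ M12`, `0 < aC ≤ a12`, `0 < δC`, `Bz ≥ B12₃` and, above them, the letters `q2 q1` (at δ12₃), `gQs2 dgQs` (at δ12₃), `c2 c12` (p = 2) and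
`c1_1` (p = 1) (at δC), all with the constant `Bz` and the certificate's weight `n⁻¹`, and the packaged row-20 record `LettersHZ … Bz (min δ12₃ δC)` —
`…N06ZLettersLegAtPinsPU.zletters_of_pins`'s conclusion VERBATIM.
[cite: Balaban1985BackgroundPropagators, Thm 3.12 pp.421–423, Thm 3.13 p.426, (3.132) p.422, (3.126) p.420, (3.115) p.418, (3.42)–(3.43) pp.397–398, (3.12)–(3.14) p.393, p.398 (remark after (3.47)); Balaban1984PropagatorsII, (2.51)–(2.56) pp.232–233, Lemma 2.1 (2.60)–(2.61) p.234] -/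
theorem zletters_of_laws (θ : Stage3Params) (Mstar : ℕ) {R₁ R₂ : RegFamY θ.d₆ θ.ℓ₆ θ.hd' θ.hL' θ.b₀ θ.b₁ Mstar (Matrix (Fin N) (Fin N) ℂ)} {c : ℝ}
    [∀ x : MemberY θ.d₆ θ.ℓ₆ θ.hd' θ.hL' θ.b₀ θ.b₁ Mstar, Fintype (geo9Y x).Site]
    (𝔮 : QFamY N θ) (𝔮s : QsFamY N θ) (parS : ∀ i : KIdx θ.d₆ θ.ℓ₆ θ.hd' θ.hL' θ.b₀ θ.b₁, SiteParY (Matrix (Fin N) (Fin N) ℂ) i)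
    (Δ2 : ∀ x : MemberY θ.d₆ θ.ℓ₆ θ.hd' θ.hL' θ.b₀ θ.b₁ Mstar, BondOpY (Matrix (Fin N) (Fin N) ℂ) x.toKIdx)
    (H12 : MemberY θ.d₆ θ.ℓ₆ θ.hd' θ.hL' θ.b₀ θ.b₁ Mstar → Prop) {W12 : MemberY θ.d₆ θ.ℓ₆ θ.hd' θ.hL' θ.b₀ θ.b₁ Mstar → Type} [∀ x, Fintype (W12 x)]
    (𝔬12 : ∀ x : MemberY θ.d₆ θ.ℓ₆ θ.hd' θ.hL' θ.b₀ θ.b₁ Mstar, B9Thm312Whole.Ops (geo9Y x) (bg9YR (Matrix (Fin N) (Fin N) ℂ) (specialUnitaryUnits (Fin N)) R₁ R₂ x) (XBK (TrIdx N) x.toKIdx) (XBK (TrIdx N) x.toKIdx) (XHK (TrIdx N) x.toKIdx) (W12 x))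
    (hblkZ12 : ∀ x : MemberY θ.d₆ θ.ℓ₆ θ.hd' θ.hL' θ.b₀ θ.b₁ Mstar, (𝔬12 x).blkZ = blkHK x.toKIdx)
    -- [CASCADE-K] the pins of `C ∕ C₁` over node00-def-Y's `𝔮`-generic models (`Node00.OpsYOps312OfRecordPar.pins312Par_of_eq`, conjuncts 16–17)
    (hCco12 : ∀ (x : MemberY θ.d₆ θ.ℓ₆ θ.hd' θ.hL' θ.b₀ θ.b₁ Mstar) (U : (bg9YR (Matrix (Fin N) (Fin N) ℂ) (specialUnitaryUnits (Fin N)) R₁ R₂ x).Cfg), (𝔬12 x).C U = CcoKq x.toKIdx (trBasis N) (bg9YR (Matrix (Fin N) (Fin N) ℂ) (specialUnitaryUnits (Fin N)) R₁ R₂ x) (fun U => U) (𝔮 x.toKIdx) (𝔮s x.toKIdx) (parS x.toKIdx) (GpPhysY x.toKIdx (parS x.toKIdx)) U)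
    (hC1co12 : ∀ (x : MemberY θ.d₆ θ.ℓ₆ θ.hd' θ.hL' θ.b₀ θ.b₁ Mstar) (U : (bg9YR (Matrix (Fin N) (Fin N) ℂ) (specialUnitaryUnits (Fin N)) R₁ R₂ x).Cfg), (𝔬12 x).C1 U = C1coKq x.toKIdx (trBasis N) (bg9YR (Matrix (Fin N) (Fin N) ℂ) (specialUnitaryUnits (Fin N)) R₁ R₂ x) (fun U => U) (𝔮 x.toKIdx) (𝔮s x.toKIdx) (parS x.toKIdx) (GpPhysY x.toKIdx (parS x.toKIdx)) (Δ2 x) U)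
    {M12 a12 B12₀ B12₃ δ12₀ δ12₃ σ12 : ℝ} (ha12 : 0 < a12) (hB12₀ : 0 ≤ B12₀) (hB12₃ : 0 ≤ B12₃) (hσ12 : 0 < σ12) (hδ30 : 0 < δ12₃) (hδ₃₀ : δ12₃ ≤ δ12₀)
    -- [CASCADE-K] THE AVERAGING LETTER's `Q`-LETTERS AT THE MEMBER, DISPLAYED (today: dag-n06-w5's `hasMaj_Q_of_pins` at the straight pair + the (2.60) numerics; knit: dag-n06-c's (L7) sizes)
    (BQp : ℝ) (hBQp : 0 ≤ BQp)
    (hqK : ∀ x : MemberY θ.d₆ θ.ℓ₆ θ.hd' θ.hL' θ.b₀ θ.b₁ Mstar, M12 ≤ (geo9Y x).M → ∀ α₀ : ℝ, 0 < α₀ → (geo9Y x).M * α₀ ≤ a12 →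
      ∀ U : (bg9YR (Matrix (Fin N) (Fin N) ℂ) (specialUnitaryUnits (Fin N)) R₁ R₂ x).Cfg, (bg9YR (Matrix (Fin N) (Fin N) ℂ) (specialUnitaryUnits (Fin N)) R₁ R₂ x).Reg335 c α₀ U →
        ∀ p : ℕ, p ≤ 2 → HasMaj (cNorm 1 (H12 x) (𝔬12 x).blk (fun y => (geo9Y_len_pos x y).le) p) (cNorm 1 (H12 x) (𝔬12 x).blkZ (fun y => (geo9Y_len_pos x y).le) p) ((𝔬12 x).Q U)
          (fun a b => BQp * Real.exp (-(δ12₃ * (geo9Y x).dist a b))))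
    -- [CASCADE-K] THE AVERAGING LETTER's `Q⋆`-MAJORANT AT THE MEMBER, DISPLAYED (`…N06G0QstarLettersLegAtPinsPUPar`'s `hqsK`, same shape)
    (BQ δQ : ℝ) (hBQ : 0 ≤ BQ) (hδQ : δ12₃ + σ12 ≤ δQ)
    (hqsK : ∀ x : MemberY θ.d₆ θ.ℓ₆ θ.hd' θ.hL' θ.b₀ θ.b₁ Mstar, M12 ≤ (geo9Y x).M → ∀ α₀ : ℝ, 0 < α₀ → (geo9Y x).M * α₀ ≤ a12 →
      ∀ U : (bg9YR (Matrix (Fin N) (Fin N) ℂ) (specialUnitaryUnits (Fin N)) R₁ R₂ x).Cfg, (bg9YR (Matrix (Fin N) (Fin N) ℂ) (specialUnitaryUnits (Fin N)) R₁ R₂ x).Reg335 c α₀ U →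
        HasMaj (weightNorm (BlockNorm.ofBlocks (toB6 (geo9Y x) 1 (H12 x)) (𝔬12 x).blkZ) (fun y => ((((θ.ℓ₆ + 1 : ℕ) : ℝ) ^ (θ.d₆ + 1)) ^ lvl x.hN x.D x.hk y)⁻¹) (fun y => (plateau_pos x.toKIdx y).le))
          (cNorm 1 (H12 x) (𝔬12 x).blk (fun y => (geo9Y_len_pos x y).le) 0) ((𝔬12 x).Qstar U) (fun a a' => BQ * Real.exp (-(δQ * (geo9Y x).dist a a'))))
    (hG0e : ∀ x : MemberY θ.d₆ θ.ℓ₆ θ.hd' θ.hL' θ.b₀ θ.b₁ Mstar, M12 ≤ (geo9Y x).M → ∀ α₀ : ℝ, 0 < α₀ → (geo9Y x).M * α₀ ≤ a12 → ∀ U : (bg9YR (Matrix (Fin N) (Fin N) ℂ) (specialUnitaryUnits (Fin N)) R₁ R₂ x).Cfg, (bg9YR (Matrix (Fin N) (Fin N) ℂ) (specialUnitaryUnits (Fin N)) R₁ R₂ x).Reg335 c α₀ U →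
      (bg9YR (Matrix (Fin N) (Fin N) ℂ) (specialUnitaryUnits (Fin N)) R₁ R₂ x).Reg336 c α₀ U → Thm33G0 (𝔬12 x) 1 (H12 x) B12₀ δ12₀ U)
    (he1 : ∀ x : MemberY θ.d₆ θ.ℓ₆ θ.hd' θ.hL' θ.b₀ θ.b₁ Mstar, M12 ≤ (geo9Y x).M → ∀ α₀ : ℝ, 0 < α₀ → (geo9Y x).M * α₀ ≤ a12 → ∀ U : (bg9YR (Matrix (Fin N) (Fin N) ℂ) (specialUnitaryUnits (Fin N)) R₁ R₂ x).Cfg, (bg9YR (Matrix (Fin N) (Fin N) ℂ) (specialUnitaryUnits (Fin N)) R₁ R₂ x).Reg335 c α₀ U →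
      (bg9YR (Matrix (Fin N) (Fin N) ℂ) (specialUnitaryUnits (Fin N)) R₁ R₂ x).Reg336 c α₀ U → HasMajorantHom (g := toB6 (geo9Y x) 1 (H12 x)) (𝔬12 x).blk (𝔬12 x).blkY ((𝔬12 x).D U ∘ₗ (𝔬12 x).G0 U) (fun (a b : (geo9Y x).Site) => B12₀ * (geo9Y x).len a * Real.exp (-(δ12₀ * (geo9Y x).dist a b))))
    (h26 : B9.Stmt3132Printed (θ.d₆ + 1) c (geo9Y (d := θ.d₆) (ℓ := θ.ℓ₆) (hd := θ.hd') (hL := θ.hL') (b₀ := θ.b₀) (b₁ := θ.b₁) (Mstar := Mstar))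
      (fun x => bg9YR (Matrix (Fin N) (Fin N) ℂ) (specialUnitaryUnits (Fin N)) R₁ R₂ x)
      (fun x => siteKernelOfOpNu x.toKIdx (bg9YR (Matrix (Fin N) (Fin N) ℂ) (specialUnitaryUnits (Fin N)) R₁ R₂ x) (fun U => U) (nuY (θ.d₆ + 1) x.toKIdx) (QGQinvQY x.toKIdx (𝔮 x.toKIdx) (𝔮s x.toKIdx) (parS x.toKIdx) (GpPhysY x.toKIdx (parS x.toKIdx))))
      (fun x => siteKernelOfOpNu x.toKIdx (bg9YR (Matrix (Fin N) (Fin N) ℂ) (specialUnitaryUnits (Fin N)) R₁ R₂ x) (fun U => U) (nuY (θ.d₆ + 1) x.toKIdx) (QG1QinvQY x.toKIdx (𝔮 x.toKIdx) (𝔮s x.toKIdx) (parS x.toKIdx) (GpPhysY x.toKIdx (parS x.toKIdx)) (Δ2 x)))) :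
    ∃ Mz aC δC Bz : ℝ, M12 ≤ Mz ∧ 0 < aC ∧ aC ≤ a12 ∧ 0 < δC ∧ B12₃ ≤ Bz ∧
      ∀ x : MemberY θ.d₆ θ.ℓ₆ θ.hd' θ.hL' θ.b₀ θ.b₁ Mstar, Mz ≤ (geo9Y x).M → ∀ α₀ : ℝ, 0 < α₀ → (geo9Y x).M * α₀ ≤ aC → ∀ U : (bg9YR (Matrix (Fin N) (Fin N) ℂ) (specialUnitaryUnits (Fin N)) R₁ R₂ x).Cfg, (bg9YR (Matrix (Fin N) (Fin N) ℂ) (specialUnitaryUnits (Fin N)) R₁ R₂ x).Reg335 c α₀ U → (bg9YR (Matrix (Fin N) (Fin N) ℂ) (specialUnitaryUnits (Fin N)) R₁ R₂ x).Reg336 c α₀ U →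
        (∀ p : ℕ, p ≤ 2 → HasMaj (cNorm 1 (H12 x) (𝔬12 x).blk (fun y => (geo9Y_len_pos x y).le) p) (cNorm 1 (H12 x) (𝔬12 x).blkZ (fun y => (geo9Y_len_pos x y).le) p) ((𝔬12 x).Q U) (fun a b => Bz * Real.exp (-(δ12₃ * (geo9Y x).dist a b)))) ∧
        HasMaj (weightNorm (BlockNorm.ofBlocks (toB6 (geo9Y x) 1 (H12 x)) (𝔬12 x).blkZ) (fun y => ((((θ.ℓ₆ + 1 : ℕ) : ℝ) ^ (θ.d₆ + 1)) ^ lvl x.hN x.D x.hk y)⁻¹) (fun y => (plateau_pos x.toKIdx y).le)) (cNorm 1 (H12 x) (𝔬12 x).blk (fun y => (geo9Y_len_pos x y).le) 2) ((𝔬12 x).G0 U ∘ₗ (𝔬12 x).Qstar U) (fun a b => Bz * Real.exp (-(δ12₃ * (geo9Y x).dist a b))) ∧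
        HasMaj (weightNorm (BlockNorm.ofBlocks (toB6 (geo9Y x) 1 (H12 x)) (𝔬12 x).blkZ) (fun y => ((((θ.ℓ₆ + 1 : ℕ) : ℝ) ^ (θ.d₆ + 1)) ^ lvl x.hN x.D x.hk y)⁻¹) (fun y => (plateau_pos x.toKIdx y).le)) (cNorm 1 (H12 x) (𝔬12 x).blkY (fun y => (geo9Y_len_pos x y).le) 1) ((𝔬12 x).D U ∘ₗ (𝔬12 x).G0 U ∘ₗ (𝔬12 x).Qstar U) (fun a b => Bz * Real.exp (-(δ12₃ * (geo9Y x).dist a b))) ∧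
        HasMaj (cNorm 1 (H12 x) (𝔬12 x).blkZ (fun y => (geo9Y_len_pos x y).le) 2) (weightNorm (BlockNorm.ofBlocks (toB6 (geo9Y x) 1 (H12 x)) (𝔬12 x).blkZ) (fun y => ((((θ.ℓ₆ + 1 : ℕ) : ℝ) ^ (θ.d₆ + 1)) ^ lvl x.hN x.D x.hk y)⁻¹) (fun y => (plateau_pos x.toKIdx y).le)) ((𝔬12 x).C U) (fun a b => Bz * Real.exp (-(δC * (geo9Y x).dist a b))) ∧
        HasMaj (cNorm 1 (H12 x) (𝔬12 x).blkZ (fun y => (geo9Y_len_pos x y).le) 2) (weightNorm (BlockNorm.ofBlocks (toB6 (geo9Y x) 1 (H12 x)) (𝔬12 x).blkZ) (fun y => ((((θ.ℓ₆ + 1 : ℕ) : ℝ) ^ (θ.d₆ + 1)) ^ lvl x.hN x.D x.hk y)⁻¹) (fun y => (plateau_pos x.toKIdx y).le)) ((𝔬12 x).C1 U) (fun a b => Bz * Real.exp (-(δC * (geo9Y x).dist a b))) ∧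
        HasMaj (cNorm 1 (H12 x) (𝔬12 x).blkZ (fun y => (geo9Y_len_pos x y).le) 1) (weightNorm (BlockNorm.ofBlocks (toB6 (geo9Y x) 1 (H12 x)) (𝔬12 x).blkZ) (fun y => (geo9Y x).len y * ((((θ.ℓ₆ + 1 : ℕ) : ℝ) ^ (θ.d₆ + 1)) ^ lvl x.hN x.D x.hk y)⁻¹) (fun y => (mul_pos (geo9Y_len_pos x y) (plateau_pos x.toKIdx y)).le)) ((𝔬12 x).C1 U) (fun a b => Bz * Real.exp (-(δC * (geo9Y x).dist a b))) ∧
        LettersHZ (𝔬12 x) 1 (H12 x) ⟨geo9Y_dist_triangle x, geo9Y_dist_comm x, geo9K_dist_nonneg x.toKIdx, geo9Y_len_pos x⟩ (weightNorm (BlockNorm.ofBlocks (toB6 (geo9Y x) 1 (H12 x)) (𝔬12 x).blkZ) (fun y => ((((θ.ℓ₆ + 1 : ℕ) : ℝ) ^ (θ.d₆ + 1)) ^ lvl x.hN x.D x.hk y)⁻¹) (fun y => (plateau_pos x.toKIdx y).le)) Bz (min δ12₃ δC) U := by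
  have hgeoOK : ∀ x : MemberY θ.d₆ θ.ℓ₆ θ.hd' θ.hL' θ.b₀ θ.b₁ Mstar, GeoOK (geo9Y x) := fun x => ⟨geo9Y_dist_triangle x, geo9Y_dist_comm x, geo9K_dist_nonneg x.toKIdx, geo9Y_len_pos x⟩
  -- ROW 26 ⟹ the three (3.132) class letters with produced (M₄, δC, a₀C, BC), operator-generically (§1) at `T := QGQinvQY …`, `T₁ := QG1QinvQY …`
  obtain ⟨M₄, δC, a₀C, BC, hM₄, hδC, ha₀C, hBC, hCfam⟩ := c_letters_of_row26K (fun x => (bg9YR (Matrix (Fin N) (Fin N) ℂ) (specialUnitaryUnits (Fin N)) R₁ R₂ x)) (fun x => fun U => U)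
    (fun x => QGQinvQY x.toKIdx (𝔮 x.toKIdx) (𝔮s x.toKIdx) (parS x.toKIdx) (GpPhysY x.toKIdx (parS x.toKIdx)))
    (fun x => QG1QinvQY x.toKIdx (𝔮 x.toKIdx) (𝔮s x.toKIdx) (parS x.toKIdx) (GpPhysY x.toKIdx (parS x.toKIdx)) (Δ2 x)) 𝔬12 H12 hblkZ12
    (fun x U => hCco12 x U) (fun x U => hC1co12 x U) (fun x y => (plateau_pos x.toKIdx y).le) (fun x y => (mul_pos (geo9Y_len_pos x y) (plateau_pos x.toKIdx y)).le) h26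
  -- a [4] (2.61) row sum at rate σ12 for the G₀Q* compositions
  obtain ⟨ML, cL, hrowL⟩ := rowSum261_geo9Y (d := θ.d₆) (ℓ := θ.ℓ₆) (hd := θ.hd') (hL := θ.hL') (b₀ := θ.b₀) (b₁ := θ.b₁) (Mstar := Mstar) σ12 hσ12
  have hrow : ∀ x : MemberY θ.d₆ θ.ℓ₆ θ.hd' θ.hL' θ.b₀ θ.b₁ Mstar, ML ≤ (geo9Y x).M → RowSum (toB6 (geo9Y x) 1 (H12 x)) σ12 (max cL 0) := fun x hM y => (hrowL x hM y).trans (le_max_left _ _)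
  have hc : (0 : ℝ) ≤ max cL 0 := le_max_right _ _
  set BQ' : ℝ := B12₀ * BQ * max cL 0 with hBQd
  set Bz : ℝ := max (max (max B12₃ BQp) BQ') BC with hBzd
  have hB3z : B12₃ ≤ Bz := ((le_max_left _ _).trans (le_max_left _ _)).trans (le_max_left _ _)
  have hBQpz : BQp ≤ Bz := ((le_max_right _ _).trans (le_max_left _ _)).trans (le_max_left _ _)
  have hBQz : BQ' ≤ Bz := (le_max_right _ _).trans (le_max_left _ _)
  have hBCz : BC ≤ Bz := le_max_right _ _
  refine ⟨max M12 (max ML M₄), min a12 a₀C, δC, Bz, le_max_left _ _, lt_min ha12 ha₀C, min_le_left _ _, hδC, hB3z, fun x hM α₀ hα ha U hU hU' => ?_⟩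
  have hM12x : M12 ≤ (geo9Y x).M := (le_max_left _ _).trans hM
  have hMLx : ML ≤ (geo9Y x).M := ((le_max_left _ _).trans (le_max_right _ _)).trans hM
  have hM4x : M₄ ≤ (geo9Y x).M := ((le_max_right _ _).trans (le_max_right _ _)).trans hM
  have ha12x : (geo9Y x).M * α₀ ≤ a12 := ha.trans (min_le_left _ _)
  have haCx : (geo9Y x).M * α₀ ≤ a₀C := ha.trans (min_le_right _ _)
  have kq : ∀ a b : (geo9Y x).Site, BQp * Real.exp (-(δ12₃ * (geo9Y x).dist a b)) ≤ Bz * Real.exp (-(δ12₃ * (geo9Y x).dist a b)) :=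
    fun a b => kernel_mono (hgeoOK x) hBQp hBQpz (le_refl δ12₃) a b
  have kC : ∀ a b : (geo9Y x).Site, BC * Real.exp (-(δC * (geo9Y x).dist a b)) ≤ Bz * Real.exp (-(δC * (geo9Y x).dist a b)) :=
    fun a b => kernel_mono (hgeoOK x) hBC.le hBCz (le_refl δC) a b
  -- the letters of Q: the displayed law, weakened to Bz
  have hq := hqK x hM12x α₀ hα ha12x U hU
  -- G₀Q* and ∇_UG₀Q* from the G₀ layer and the displayed Q⋆-law (constant B12₀·BQ·c ≤ Bz, rate δ12₃; `gQs2_of_e0 ∕ dgQs_of_e1`)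
  have hqs := hqsK x hM12x α₀ hα ha12x U hU
  have hgQs2 := gQs2_of_e0 (hgeoOK x) (hrow x hMLx) hB12₀ hBQ hc hδ30.le hδ₃₀ hδQ hBQz (hG0e x hM12x α₀ hα ha12x U hU hU').e0 hqs
  have hdgQs := dgQs_of_e1 (hgeoOK x) (hrow x hMLx) hB12₀ hBQ hc hδ30.le hδ₃₀ hδQ hBQz (he1 x hM12x α₀ hα ha12x U hU hU') hqs
  have hC := hCfam x hM4x α₀ hα haCx U hU hU'
  have hBz0 : 0 ≤ Bz := hB12₃.trans hB3z
  have kH : ∀ a b : (geo9Y x).Site, Bz * Real.exp (-(δ12₃ * (geo9Y x).dist a b)) ≤ Bz * Real.exp (-(min δ12₃ δC * (geo9Y x).dist a b)) :=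
    fun a b => kernel_mono (hgeoOK x) hBz0 (le_refl Bz) (min_le_left δ12₃ δC) a b
  have kCH : ∀ a b : (geo9Y x).Site, BC * Real.exp (-(δC * (geo9Y x).dist a b)) ≤ Bz * Real.exp (-(min δ12₃ δC * (geo9Y x).dist a b)) :=
    fun a b => kernel_mono (hgeoOK x) hBC.le hBCz (min_le_right δ12₃ δC) a b
  exact ⟨fun p hp => (hq p hp).mono kq, hgQs2, hdgQs, hC.1.mono kC, hC.2.1.mono kC, hC.2.2.mono kC,
    ⟨hgQs2.mono kH, hdgQs.mono kH, hC.1.mono kCH, hC.2.1.mono kCH⟩⟩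

end Summit.QuantumFields.YangMills.BalabanUVNodes.N06ZLettersLegAtPinsPUPar

end
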